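import Mathlib
import HarnessLib
import Literature.LinearAlgebra.Matrix.CollatzWielandtUpperBound

/-!
# Collatz–Wielandt lower bound: `A ≥ 0`, `x ≥ 0`, `x ≠ 0`, `α x ≤ A x` ⇒ `α ≤ ρ(A)`

Topic `Literature/LinearAlgebra/Matrix`; support file (everything PROVED; no definitions; no named
facts). Companion of `CollatzWielandtUpperBound.lean` (the upper half `A x ≤ β x, x ≫ 0 ⇒
ρ(A) ≤ β`).

Horn–Johnson, *Matrix Analysis* (2nd ed.), Thm. 8.3.2: for a nonnegative square matrix `A` and a
nonnegative NONZERO vector `x`, `A x ≥ α x` implies `ρ(A) ≥ α` ("the half of (8.1.29) that remains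
correct for nonnegative matrices and vectors"); with `x ≫ 0` this is the lower half of
Cor. 8.1.29 / of the Collatz quotient enclosure (8.1.27)
`minᵢ (A x)ᵢ / xᵢ ≤ ρ(A) ≤ maxᵢ (A x)ᵢ / xᵢ`, and with `x = 𝟙` the lower row-sum bound of
Thm. 8.1.22 `minᵢ Σⱼ aᵢⱼ ≤ ρ(A)`; Cor. 8.1.30: a positive eigenvector belongs to the eigenvalue
`ρ(A)`.

The book proves 8.3.2 from the Perron vector of `A + εJ`. Typed here WITHOUT Perron–Frobenius,
through GELFAND'S FORMULA (`Mathlib`: `spectrum.pow_nnnorm_pow_one_div_tendsto_nhds_spectralRadius`)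
in the Banach algebra `Matrix n n ℂ` with the `ℓ∞`-operator norm (`Matrix.linftyOpNormedAlgebra`,
a local instance): `A ≥ 0` is entrywise monotone, so `α x ≤ A x` iterates to `αᵏ x ≤ Aᵏ x`,
whence `αᵏ ‖x‖_∞ ≤ ‖Aᵏ x‖_∞ ≤ ‖Aᵏ‖ ‖x‖_∞`, i.e. `α ≤ ‖Aᵏ‖^{1/k}` for every `k ≥ 1`, and
`‖Aᵏ‖^{1/k} → ρ(A)`.
* `pow_mul_le_linfty_opNorm_pow_mul` — the finite-`k` form `αᵏ ‖x‖ ≤ ‖Aᵏ‖ ‖x‖`;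
* `ofReal_le_spectralRadius_of_smul_le_mulVec` — `ENNReal.ofReal α ≤ spectralRadius ℂ A_ℂ`
  (`A_ℂ = A.map (algebraMap ℝ ℂ)` in the matrix algebra) and `…_toLin'…` (for `Matrix.toLin' A_ℂ`);
* `exists_mem_spectrum_toLin'_le_norm` — some eigenvalue `μ` of `A_ℂ` has `α ≤ ‖μ‖`;
* `ofReal_le_spectralRadius_toLin'_of_le_rowSum` — `minᵢ Σⱼ aᵢⱼ ≤ ρ(A)` (Thm. 8.1.22, lower);
* `spectralRadius_toLin'_eq_of_pos_eigenvector` — Cor. 8.1.30 (with the upper half of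
  `CollatzWielandtUpperBound.lean`).

NOT TYPED here: the strict versions (`α x < A x ⇒ α < ρ(A)`), the `max min` characterisation
Cor. 8.3.3 as an equality (only `≥`, i.e. this file, holds without a Perron eigenvector), column
forms (apply the row forms to `Aᵀ`).

References:
* R. A. Horn, C. R. Johnson, *Matrix Analysis*, 2nd ed., Cambridge University Press 2013,
  Thm. 8.3.2, Cor. 8.3.3, Thm. 8.1.22, Thm. 8.1.26 (8.1.27), Cor. 8.1.29, Cor. 8.1.30. Held copy
  `book:horn2012-matrix-analysis`, PDF pp. 633–635 and 642–643. [HornJohnson2013]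
* A. Berman, R. J. Plemmons, *Nonnegative Matrices in the Mathematical Sciences*, SIAM Classics 9
  (1994), Ch. 2, Thm. (1.11) (Collatz–Wielandt function). [BermanPlemmons1994]
-/

namespace Literature.LinearAlgebra.Matrix

open scoped _root_.Matrix _root_.ENNReal _root_.NNReal _root_.Topology
open Finset _root_.Matrix Filter

variable {n : Type*} [Fintype n] [DecidableEq n]

omit [DecidableEq n] in
/-- Entrywise monotonicity of a nonnegative matrix: `0 ≤ A`, `u ≤ v` ⇒ `A u ≤ A v`. [folklore] -/
private theorem mulVec_mono_of_nonneg {A : Matrix n n ℝ} (hA : ∀ i j, 0 ≤ A i j) {u v : n → ℝ}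
    (huv : u ≤ v) : A *ᵥ u ≤ A *ᵥ v := by
  intro i
  simp only [mulVec, dotProduct]
  exact sum_le_sum fun j _ => mul_le_mul_of_nonneg_left (huv j) (hA i j)

/-- Iteration: `0 ≤ A`, `0 ≤ α`, `α • x ≤ A x` ⇒ `αᵏ • x ≤ Aᵏ x`. [folklore] -/
private theorem pow_smul_le_pow_mulVec {A : Matrix n n ℝ} (hA : ∀ i j, 0 ≤ A i j) {x : n → ℝ}
    {α : ℝ} (hα : 0 ≤ α) (h : α • x ≤ A *ᵥ x) (k : ℕ) : α ^ k • x ≤ (A ^ k) *ᵥ x := by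
  induction k with
  | zero => simp
  | succ k ih =>
    have h1 : (A ^ (k + 1)) *ᵥ x = A *ᵥ ((A ^ k) *ᵥ x) := by
      rw [pow_succ', ← Matrix.mulVec_mulVec]
    rw [h1]
    calc α ^ (k + 1) • x = α ^ k • (α • x) := by rw [pow_succ, mul_smul]
      _ ≤ α ^ k • (A *ᵥ x) := smul_le_smul_of_nonneg_left h (pow_nonneg hα k)
      _ = A *ᵥ (α ^ k • x) := by rw [Matrix.mulVec_smul]
      _ ≤ A *ᵥ ((A ^ k) *ᵥ x) := mulVec_mono_of_nonneg hA ih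

omit [DecidableEq n] in
/-- Sup norm is monotone on nonnegative vectors: `0 ≤ u ≤ v` ⇒ `‖u‖ ≤ ‖v‖`. [folklore] -/
private theorem pi_norm_le_of_nonneg_of_le {u v : n → ℝ} (hu : 0 ≤ u) (huv : u ≤ v) :
    ‖u‖ ≤ ‖v‖ := by
  refine (pi_norm_le_iff_of_nonneg (norm_nonneg v)).2 fun i => ?_
  calc ‖u i‖ = u i := Real.norm_of_nonneg (hu i)
    _ ≤ v i := huv i
    _ = ‖v i‖ := (Real.norm_of_nonneg ((hu i).trans (huv i))).symm
    _ ≤ ‖v‖ := norm_le_pi_norm v i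

section LinftyOp

attribute [local instance] Matrix.linftyOpNormedRing Matrix.linftyOpNormedAlgebra

/-- **Finite-`k` certificate form** (ℓ∞ operator norm `‖M‖ = maxᵢ Σⱼ |mᵢⱼ|`): if `A ≥ 0`,
`0 ≤ x`, `0 ≤ α` and `α xᵢ ≤ (A x)ᵢ` for all `i`, then `αᵏ ‖x‖_∞ ≤ ‖Aᵏ‖ ‖x‖_∞` for every `k`
(so `α ≤ ‖Aᵏ‖^{1/k}` when `x ≠ 0`). [cite: HornJohnson2013, Thm. 8.3.2 (proof-free of
Perron–Frobenius: the k-th power step of the Gelfand-formula argument)] -/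
theorem pow_mul_le_linfty_opNorm_pow_mul {A : Matrix n n ℝ} (hA : ∀ i j, 0 ≤ A i j)
    {x : n → ℝ} (hx : 0 ≤ x) {α : ℝ} (hα : 0 ≤ α) (h : ∀ i, α * x i ≤ (A *ᵥ x) i) (k : ℕ) :
    α ^ k * ‖x‖ ≤ ‖A ^ k‖ * ‖x‖ := by
  have h' : α • x ≤ A *ᵥ x := fun i => by simpa [Pi.smul_apply, smul_eq_mul] using h i
  have hk := pow_smul_le_pow_mulVec hA hα h' k
  have hnn : 0 ≤ α ^ k • x := fun i => by
    simpa [Pi.smul_apply, smul_eq_mul] using mul_nonneg (pow_nonneg hα k) (hx i)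
  calc α ^ k * ‖x‖ = ‖α ^ k • x‖ := by
        rw [norm_smul, Real.norm_of_nonneg (pow_nonneg hα k)]
    _ ≤ ‖(A ^ k) *ᵥ x‖ := pi_norm_le_of_nonneg_of_le hnn hk
    _ ≤ ‖A ^ k‖ * ‖x‖ := Matrix.linfty_opNorm_mulVec _ _

/-- The ℓ∞ operator norm is unchanged by complexification. [folklore] -/
private theorem linfty_opNNNorm_map_ofReal (M : Matrix n n ℝ) :
    ‖M.map (algebraMap ℝ ℂ)‖₊ = ‖M‖₊ := by
  simp [Matrix.linfty_opNNNorm_def, Matrix.map_apply]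

/-- **Collatz–Wielandt lower bound** (Horn–Johnson Thm. 8.3.2), matrix-algebra form: if `A ≥ 0`
entrywise, `x ≥ 0`, `x ≠ 0` and `α xᵢ ≤ (A x)ᵢ` for all `i`, then `α ≤ ρ(A)`, the spectral radius
of the complexified matrix `A.map (algebraMap ℝ ℂ)` in `Matrix n n ℂ`. Proof by Gelfand's formula,
no Perron–Frobenius. [cite: HornJohnson2013, Thm. 8.3.2] -/
theorem ofReal_le_spectralRadius_of_smul_le_mulVec {A : Matrix n n ℝ} (hA : ∀ i j, 0 ≤ A i j)
    {x : n → ℝ} (hx : 0 ≤ x) (hx0 : x ≠ 0) {α : ℝ} (h : ∀ i, α * x i ≤ (A *ᵥ x) i) :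
    ENNReal.ofReal α ≤ spectralRadius ℂ (A.map (algebraMap ℝ ℂ)) := by
  rcases lt_or_ge α 0 with hα | hα
  · simp [ENNReal.ofReal_of_nonpos hα.le]
  set B : Matrix n n ℂ := A.map (algebraMap ℝ ℂ) with hB
  have hxpos : 0 < ‖x‖ := norm_pos_iff.2 hx0
  -- αᵏ ≤ ‖Bᵏ‖ for every k
  have hpow : ∀ k : ℕ, (Real.toNNReal α : ℝ≥0) ^ k ≤ ‖B ^ k‖₊ := by
    intro k
    have h1 : α ^ k ≤ ‖A ^ k‖ :=
      le_of_mul_le_mul_right (pow_mul_le_linfty_opNorm_pow_mul hA hx hα h k) hxpos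
    have h2 : ‖B ^ k‖₊ = ‖A ^ k‖₊ := by
      rw [hB, ← Matrix.map_pow, linfty_opNNNorm_map_ofReal]
    rw [h2, ← NNReal.coe_le_coe, NNReal.coe_pow, Real.coe_toNNReal α hα]
    exact h1
  -- pass to the limit in Gelfand's formula
  have hlim := spectrum.pow_nnnorm_pow_one_div_tendsto_nhds_spectralRadius B
  have hev : ∀ᶠ k : ℕ in atTop,
      ENNReal.ofReal α ≤ ((‖B ^ k‖₊ : ℝ≥0∞)) ^ (1 / (k : ℝ)) := by
    refine eventually_atTop.2 ⟨1, fun k hk => ?_⟩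
    have hk0 : (k : ℝ) ≠ 0 := Nat.cast_ne_zero.2 (by omega)
    have hk' : k ≠ 0 := by omega
    calc ENNReal.ofReal α = ((Real.toNNReal α : ℝ≥0) : ℝ≥0∞) := rfl
      _ = ((((Real.toNNReal α : ℝ≥0) : ℝ≥0∞) ^ k)) ^ (1 / (k : ℝ)) := by
          rw [one_div, ENNReal.pow_rpow_inv_natCast hk']
      _ ≤ ((‖B ^ k‖₊ : ℝ≥0∞)) ^ (1 / (k : ℝ)) := by
          gcongr
          exact_mod_cast hpow k
  exact ge_of_tendsto hlim hev

end LinftyOp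

section ToLin

/-- The spectrum of `Matrix.toLin' B` is the spectrum of `B` in the matrix algebra
(`Matrix.toLinAlgEquiv'` is an algebra equivalence). [folklore] -/
private theorem spectrum_toLin'_eq (B : Matrix n n ℂ) :
    spectrum ℂ (Matrix.toLin' B) = spectrum ℂ B :=
  AlgEquiv.spectrum_eq (Matrix.toLinAlgEquiv' : Matrix n n ℂ ≃ₐ[ℂ] _) B

/-- **Collatz–Wielandt lower bound, `toLin'` form**: `A ≥ 0`, `x ≥ 0`, `x ≠ 0`,
`α xᵢ ≤ (A x)ᵢ` ⇒ `ENNReal.ofReal α ≤ spectralRadius ℂ (Matrix.toLin' (A.map (algebraMap ℝ ℂ)))`.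
[cite: HornJohnson2013, Thm. 8.3.2] -/
theorem ofReal_le_spectralRadius_toLin'_of_smul_le_mulVec {A : Matrix n n ℝ}
    (hA : ∀ i j, 0 ≤ A i j) {x : n → ℝ} (hx : 0 ≤ x) (hx0 : x ≠ 0) {α : ℝ}
    (h : ∀ i, α * x i ≤ (A *ᵥ x) i) :
    ENNReal.ofReal α ≤ spectralRadius ℂ (Matrix.toLin' (A.map (algebraMap ℝ ℂ))) := by
  have : spectralRadius ℂ (Matrix.toLin' (A.map (algebraMap ℝ ℂ))) =
      spectralRadius ℂ (A.map (algebraMap ℝ ℂ)) := by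
    simp only [spectralRadius, spectrum_toLin'_eq]
  rw [this]
  exact ofReal_le_spectralRadius_of_smul_le_mulVec hA hx hx0 h

/-- **Some eigenvalue is at least `α` in modulus**: under the hypotheses of Thm. 8.3.2 (and `n`
nonempty) there is `μ ∈ spectrum ℂ (toLin' A_ℂ)` — i.e. an eigenvalue of `A` — with `α ≤ ‖μ‖`.
[cite: HornJohnson2013, Thm. 8.3.2] -/
theorem exists_mem_spectrum_toLin'_le_norm [Nonempty n] {A : Matrix n n ℝ}
    (hA : ∀ i j, 0 ≤ A i j) {x : n → ℝ} (hx : 0 ≤ x) (hx0 : x ≠ 0) {α : ℝ}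
    (h : ∀ i, α * x i ≤ (A *ᵥ x) i) :
    ∃ μ ∈ spectrum ℂ (Matrix.toLin' (A.map (algebraMap ℝ ℂ))), α ≤ ‖μ‖ := by
  classical
  set f := Matrix.toLin' (A.map (algebraMap ℝ ℂ)) with hf
  have hfin : (spectrum ℂ f).Finite := Module.End.finite_spectrum f
  have hne : (spectrum ℂ f).Nonempty := by
    obtain ⟨c, hc⟩ := Module.End.exists_eigenvalue f
    exact ⟨c, Module.End.hasEigenvalue_iff_mem_spectrum.1 hc⟩
  -- the sup defining the spectral radius is attained on a finite nonempty set
  obtain ⟨μ, hμ, hmax⟩ := Set.exists_max_image _ (fun μ : ℂ => ‖μ‖) hfin hne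
  refine ⟨μ, hμ, ?_⟩
  have hρ : spectralRadius ℂ f ≤ ENNReal.ofReal ‖μ‖ := by
    refine iSup₂_le fun ν hν => ?_
    change ((‖ν‖₊ : NNReal) : ℝ≥0∞) ≤ ((Real.toNNReal ‖μ‖ : NNReal) : ℝ≥0∞)
    exact ENNReal.coe_le_coe.2 ((Real.le_toNNReal_iff_coe_le (norm_nonneg μ)).2 (hmax ν hν))
  have key := (ofReal_le_spectralRadius_toLin'_of_smul_le_mulVec hA hx hx0 h).trans hρ
  exact (ENNReal.ofReal_le_ofReal_iff (norm_nonneg μ)).1 key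

/-- **Lower row-sum bound** (Horn–Johnson Thm. 8.1.22, lower half; `x = 𝟙` in Thm. 8.3.2): for
`A ≥ 0` and `n` nonempty, `α ≤ Σⱼ aᵢⱼ` for every `i` implies `α ≤ ρ(A)`; i.e.
`minᵢ Σⱼ aᵢⱼ ≤ ρ(A)`. [cite: HornJohnson2013, Thm. 8.1.22] -/
theorem ofReal_le_spectralRadius_toLin'_of_le_rowSum [Nonempty n] {A : Matrix n n ℝ}
    (hA : ∀ i j, 0 ≤ A i j) {α : ℝ} (h : ∀ i, α ≤ ∑ j, A i j) :
    ENNReal.ofReal α ≤ spectralRadius ℂ (Matrix.toLin' (A.map (algebraMap ℝ ℂ))) := by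
  refine ofReal_le_spectralRadius_toLin'_of_smul_le_mulVec hA (x := fun _ => (1 : ℝ))
    (fun _ => zero_le_one) ?_ fun i => ?_
  · exact fun h0 => one_ne_zero (congrFun h0 (Classical.arbitrary n))
  · simpa [mulVec, dotProduct] using h i

/-- **Two-sided Collatz quotient enclosure** (Horn–Johnson (8.1.27) / Cor. 8.1.29, both halves):
`A ≥ 0`, `x ≫ 0`, `α xᵢ ≤ (A x)ᵢ ≤ β xᵢ` for all `i` ⇒ `α ≤ ρ(A) ≤ β` (the upper half is
`CollatzWielandtUpperBound.lean`). [cite: HornJohnson2013, Cor. 8.1.29] -/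
theorem spectralRadius_toLin'_mem_Icc_of_pos [Nonempty n] {A : Matrix n n ℝ}
    (hA : ∀ i j, 0 ≤ A i j) {x : n → ℝ} (hx : ∀ i, 0 < x i) {α β : ℝ}
    (hα : ∀ i, α * x i ≤ (A *ᵥ x) i) (hβ : ∀ i, (A *ᵥ x) i ≤ β * x i) :
    ENNReal.ofReal α ≤ spectralRadius ℂ (Matrix.toLin' (A.map (algebraMap ℝ ℂ))) ∧
      spectralRadius ℂ (Matrix.toLin' (A.map (algebraMap ℝ ℂ))) ≤ ENNReal.ofReal β := by
  refine ⟨ofReal_le_spectralRadius_toLin'_of_smul_le_mulVec hA (fun i => (hx i).le) ?_ hα,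
    spectralRadius_toLin'_le_of_dominated (B := A.map (algebraMap ℝ ℂ)) (fun i j => by
      rw [map_apply, norm_algebraMap', Real.norm_of_nonneg (hA i j)]) hx hβ⟩
  exact fun h0 => (hx (Classical.arbitrary n)).ne' (congrFun h0 _)

/-- **A positive eigenvector belongs to `ρ(A)`** (Horn–Johnson Cor. 8.1.30): if `A ≥ 0`, `x ≫ 0`
and `A x = λ x`, then `ρ(A) = λ` (as `ENNReal.ofReal λ`; `λ ≥ 0` automatically when `n` is
nonempty). [cite: HornJohnson2013, Cor. 8.1.30] -/
theorem spectralRadius_toLin'_eq_of_pos_eigenvector [Nonempty n] {A : Matrix n n ℝ}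
    (hA : ∀ i j, 0 ≤ A i j) {x : n → ℝ} (hx : ∀ i, 0 < x i) {lam : ℝ}
    (h : A *ᵥ x = lam • x) :
    spectralRadius ℂ (Matrix.toLin' (A.map (algebraMap ℝ ℂ))) = ENNReal.ofReal lam := by
  have h1 : ∀ i, lam * x i ≤ (A *ᵥ x) i := fun i => by simp [h]
  have h2 : ∀ i, (A *ᵥ x) i ≤ lam * x i := fun i => by simp [h]
  have := spectralRadius_toLin'_mem_Icc_of_pos hA hx h1 h2
  exact le_antisymm this.2 this.1

end ToLin

end Literature.LinearAlgebra.Matrix
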